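import Mathlib
import Literature.Barriers.ValiantsHypothesis.AlgebraicNaturalProofs
import Literature.Computability.AlgebraicComplexity.ElementarySymmetricFFT
import Literature.Computability.AlgebraicComplexity.MultipointEvaluationCircuit
import Summits.ValiantsHypothesis.ValiantsHypothesis.Theorems.BarrierLeverSuccinctHittingSetsForVPStubGeneratorGlue
import HarnessLib

/-!
# Affine Lagrange seeds: the succinct Shpilka–Volkovich generator with seeds of size `O(n log² n)`
(crux stmt-ValiantsHypothesis-14610 side; docket 8745/8749 of seat val-np-p5)

**What is proved (unconditional; it does NOT close any item).** A NEW seed family for the shifted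
succinct Shpilka–Volkovich generator of the tree (`stub_svHit`, `stub_readOnceGenerator`,
`…GeneratorFour`).  The generator needs polynomial maps `L_μ(z)` with the INDICATOR property
`L_μ(pt ν) = [μ = ν]` (`μ, ν` exponent vectors of degree `≤ n`) such that every value
`Λ_z = Σ_μ L_μ(z) x^μ` is a cheap polynomial of degree `≤ n`.  FSV's Construction 25 (and the
tree) takes separable TENSORS `Λ_z = Σ_{|μ|≤n} ∏_i ℓ_{μ_i}(z_i) x^μ`, which cost `≈ 4n²` each even
with fast series arithmetic (`…SeparableCoeffFast`).  Here instead (`Z = Fin n`, one parameter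
per POSITION of a word rather than per variable):

  `Λ_σ = ∏_{r < n} R_x(σ_r)`, `R_x(σ) = Σ_{i=0}^{n} ℓ_i(σ) x̂_i`, `x̂_0 = 1`, `x̂_i = x_i`,

`ℓ_i` the Lagrange basis on the nodes `0, …, n` (`Lagrange.basis`).  At `σ = word(ν)` (the sorted
word of `x^ν` padded with the blank letter `0`) the `r`-th factor IS the `r`-th letter, so
`Λ_{word ν} = x^ν` (`seed_word`) — the indicator property (`indicator`); every member is a product
of `n` AFFINE forms, so has degree `≤ n` with no truncation (`totalDegree_seed_le`); and its cost
is ONE multipoint evaluation of the node-polynomial `R_x` (degree `n`, coefficients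
`c_k = Σ_i ℓ_i[k] x̂_i` shared by all seeds) at the `n` constants `σ_r` — `remTreeCost K =
(6K² + 15K)2^K` gates by the remainder tree (`jointlyComputed_multipoint`,
`MultipointEvaluationCircuit.lean`) — plus `n − 1` products.  Consequently the generator's value
`f₀ + Σ_{j<t} w_j Λ_{σ_j}` at ANY parameter point costs
`≤ L(f₀) + (n+1)2^K + t(remTreeCost K + n) + 1` (`complexity_value_le`), i.e. `O(t n log² n)`:
with `t = O(n)` seeds the generator lives in `SmallCircuits ℂ n 3` (file `…GeneratorThree`), the
floor of seed-by-seed realisation (`2n` generic seeds, `n − 1` products each).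

* `letter`, `lag`, `interp` (`R_x`), `seed` (`Λ_σ`), `eval_interp_node`, `totalDegree_seed_le`;
* `wordMultiset`, `word`, `prod_letter_word`, `seed_word` (`Λ_{word ν} = x^ν`);
* `genericSeed`, `Lmap` (`L_μ ∈ ℂ[Z]`), `eval_Lmap`, `indicator`;
* `jointlyComputed_seeds`, `complexity_value_le`, `realisable` (degree, size, coefficients of the
  generator's value at a point).

Honest framing: 14610-side engineering; nothing here bears on the open cruxes 8745/8749
(open at `b = 2`, Chatterjee–Tengse §1.3) or on `VP ≠ VNP`.

References: [ShpilkaVolkovich2015] Thm. 1 (the generator); [ForbesShpilkaVolk2018] §3,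
Construction 25/29, Lemma 28; [GathenGerhard2013] §10.1 (multipoint evaluation);
[Burgisser2000] Def. 2.1.
-/

-- layout Summits/ValiantsHypothesis/ValiantsHypothesis forces the duplicated namespace component
set_option linter.dupNamespace false

noncomputable section

namespace Summit.ValiantsHypothesis.ValiantsHypothesis.Theorems.BarrierLever.SuccinctHittingSetsForVP

open Literature.Barriers.ValiantsHypothesis Literature.Computability.AlgebraicComplexity MvPolynomial

namespace AffineSeeds

/-! ### A. Letters, the Lagrange kernel, the seed -/

section Seed

variable (n : ℕ)

/-- The letters `x̂_0 = 1`, `x̂_{i+1} = x_i` (over any coefficient ring). [cite: ShpilkaVolkovich2015, Thm. 1] -/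
def letter {R : Type*} [CommSemiring R] : Fin (n + 1) → MvPolynomial (Fin n) R :=
  Fin.cases 1 fun i => X i

/-- `x̂_0 = 1`. [folklore] -/
@[simp] theorem letter_zero {R : Type*} [CommSemiring R] : letter n (R := R) 0 = 1 := by
  simp [letter]

/-- `x̂_{i+1} = x_i`. [folklore] -/
@[simp] theorem letter_succ {R : Type*} [CommSemiring R] (i : Fin n) :
    letter n (R := R) i.succ = X i := by
  simp [letter]

/-- Every letter is a variable or the constant `1`. [folklore] -/
theorem letter_cases {R : Type*} [CommSemiring R] (i : Fin (n + 1)) :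
    (∃ x, letter n (R := R) i = X x) ∨ ∃ c, letter n (R := R) i = C c := by
  refine Fin.cases (Or.inr ⟨1, by simp⟩) (fun i => Or.inl ⟨i, by simp⟩) i

/-- Letters map to letters under a change of coefficients. [folklore] -/
theorem map_letter {R S : Type*} [CommSemiring R] [CommSemiring S] (φ : R →+* S)
    (i : Fin (n + 1)) : MvPolynomial.map φ (letter n i) = letter n i := by
  refine Fin.cases ?_ (fun i => ?_) i
  · simp
  · simp

/-- Letters have total degree `≤ 1`. [folklore] -/
theorem totalDegree_letter_le {R : Type*} [CommSemiring R] (i : Fin (n + 1)) :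
    (letter n (R := R) i).totalDegree ≤ 1 := by
  refine Fin.cases ?_ (fun i => ?_) i
  · simp
  · rw [letter_succ]
    show (monomial (Finsupp.single i 1) (1 : R)).totalDegree ≤ 1
    refine (totalDegree_monomial_le (Finsupp.single i 1) (1 : R)).trans (le_of_eq ?_)
    exact Finsupp.sum_single_index rfl

/-- The Lagrange basis polynomial `ℓ_i` of the nodes `0, 1, …, n` (`ℓ_i(m) = [i = m]` for
`m ≤ n`, degree `n`). [cite: ForbesShpilkaVolk2018, Construction 25] -/
def lag (i : ℕ) : Polynomial ℂ :=
  Lagrange.basis (Finset.range (n + 1)) (fun m : ℕ => (m : ℂ)) i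

/-- The nodes are distinct. [folklore] -/
theorem nodes_injOn : Set.InjOn (fun m : ℕ => (m : ℂ)) (Finset.range (n + 1) : Finset ℕ) :=
  fun a _ b _ h => by
    have h' : (a : ℂ) = (b : ℂ) := h
    exact_mod_cast h'

/-- `ℓ_i(m) = [i = m]` for `i, m ≤ n`. [cite: ForbesShpilkaVolk2018, Construction 25] -/
theorem lag_eval {i m : ℕ} (hi : i ≤ n) (hm : m ≤ n) :
    (lag n i).eval (m : ℂ) = if i = m then 1 else 0 := by
  unfold lag
  split_ifs with h
  · subst h
    exact Lagrange.eval_basis_self (nodes_injOn n) (Finset.mem_range.2 (by omega))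
  · exact Lagrange.eval_basis_of_ne h (Finset.mem_range.2 (by omega))

/-- `deg ℓ_i = n` for `i ≤ n`. [cite: ForbesShpilkaVolk2018, Construction 25] -/
theorem lag_natDegree {i : ℕ} (hi : i ≤ n) : (lag n i).natDegree = n := by
  unfold lag
  rw [Lagrange.natDegree_basis (nodes_injOn n) (Finset.mem_range.2 (by omega)),
    Finset.card_range, Nat.add_sub_cancel]

/-- **The variable-interpolant** `R_x(σ) = Σ_{i=0}^{n} ℓ_i(σ) x̂_i` as a polynomial in `σ` with node
coefficients (`R_x(m) = x̂_m`). [cite: ShpilkaVolkovich2015, Thm. 1] -/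
def interp : Polynomial (MvPolynomial (Fin n) ℂ) :=
  ∑ i : Fin (n + 1), Polynomial.C (letter n i) * (lag n i).map MvPolynomial.C

/-- `R_x(a) = Σ_i ℓ_i(a) x̂_i`. [cite: ShpilkaVolkovich2015, Thm. 1] -/
theorem eval_interp (a : ℂ) :
    (interp n).eval (C a) = ∑ i : Fin (n + 1), C ((lag n i).eval a) * letter n i := by
  rw [interp, Polynomial.eval_finsetSum]
  refine Finset.sum_congr rfl fun i _ => ?_
  rw [Polynomial.eval_mul, Polynomial.eval_C, Polynomial.eval_map, Polynomial.eval₂_hom, mul_comm]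

/-- `R_x(m) = x̂_m` at the nodes. [cite: ShpilkaVolkovich2015, Thm. 1] -/
theorem eval_interp_node (m : Fin (n + 1)) : (interp n).eval (C ((m : ℕ) : ℂ)) = letter n m := by
  rw [eval_interp]
  have h : ∀ i : Fin (n + 1), C ((lag n i).eval ((m : ℕ) : ℂ)) * letter n (R := ℂ) i =
      if i = m then letter n m else 0 := by
    intro i
    rw [lag_eval n (Nat.lt_succ_iff.1 i.isLt) (Nat.lt_succ_iff.1 m.isLt)]
    by_cases him : i = m
    · subst him; simp
    · rw [if_neg (fun h => him (Fin.ext h)), if_neg him, C_0, zero_mul]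
  rw [Finset.sum_congr rfl fun i _ => h i, Finset.sum_ite_eq' Finset.univ m, if_pos (Finset.mem_univ _)]

/-- The coefficients of `R_x`: `c_k = Σ_i ℓ_i[k] · x̂_i`. [cite: ShpilkaVolkovich2015, Thm. 1] -/
theorem coeff_interp (kk : ℕ) :
    (interp n).coeff kk = ∑ i : Fin (n + 1), (lag n i).coeff kk • letter n (R := ℂ) i := by
  rw [interp, Polynomial.finsetSum_coeff]
  refine Finset.sum_congr rfl fun i _ => ?_
  rw [Polynomial.coeff_C_mul, Polynomial.coeff_map, smul_eq_C_mul, mul_comm]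

/-- `R_x` has degree `≤ n` in `σ`. [cite: ShpilkaVolkovich2015, Thm. 1] -/
theorem coeff_interp_eq_zero {kk : ℕ} (hk : n < kk) : (interp n).coeff kk = 0 := by
  rw [coeff_interp]
  refine Finset.sum_eq_zero fun i _ => ?_
  have h : (lag n i).coeff kk = 0 :=
    Polynomial.coeff_eq_zero_of_natDegree_lt (by rw [lag_natDegree n (Nat.lt_succ_iff.1 i.isLt)]; exact hk)
  rw [h, zero_smul]

/-- **The affine Lagrange seed** `Λ_σ = ∏_{r<n} R_x(σ_r)` — a product of `n` affine forms.
[cite: ShpilkaVolkovich2015, Thm. 1] -/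
def seed (σ : Fin n → ℂ) : MvPolynomial (Fin n) ℂ := ∏ r : Fin n, (interp n).eval (C (σ r))

/-- The factors `R_x(a)` have total degree `≤ 1`. [folklore] -/
theorem totalDegree_eval_interp_le (a : ℂ) : ((interp n).eval (C a)).totalDegree ≤ 1 := by
  rw [eval_interp]
  refine totalDegree_finsetSum_le fun i _ => (totalDegree_mul _ _).trans ?_
  rw [totalDegree_C, zero_add]
  exact totalDegree_letter_le n i

/-- `deg Λ_σ ≤ n`. [cite: ShpilkaVolkovich2015, Thm. 1] -/
theorem totalDegree_seed_le (σ : Fin n → ℂ) : (seed n σ).totalDegree ≤ n := by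
  unfold seed
  refine (totalDegree_finsetProd _ _).trans ?_
  calc ∑ r : Fin n, ((interp n).eval (C (σ r))).totalDegree ≤ ∑ _r : Fin n, 1 :=
        Finset.sum_le_sum fun r _ => totalDegree_eval_interp_le n (σ r)
    _ = n := by simp

end Seed

/-! ### B. Words: `Λ_{word ν} = x^ν` -/

section Word

variable (n : ℕ)

/-- The multiset of letters of `x^ν` padded with `n − |ν|` blanks: `ν_i` copies of `i+1` and
`n − |ν|` copies of `0`. [cite: ShpilkaVolkovich2015, Thm. 1] -/
def wordMultiset (ν : Fin n →₀ ℕ) : Multiset (Fin (n + 1)) :=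
  (Finsupp.toMultiset ν).map Fin.succ + (n - ν.degree) • {0}

/-- The padded word has `n` letters when `|ν| ≤ n`. [folklore] -/
theorem card_wordMultiset (ν : Fin n →₀ ℕ) (hν : ν.degree ≤ n) :
    Multiset.card (wordMultiset n ν) = n := by
  rw [wordMultiset, Multiset.card_add, Multiset.card_map, Finsupp.card_toMultiset,
    Multiset.card_nsmul, Multiset.card_singleton, mul_one]
  have : (ν.sum fun _ => id) = ν.degree := rfl
  rw [this]; omega

/-- The sorted word of `x^ν` (length `n`) as a function on positions. [cite: ShpilkaVolkovich2015, Thm. 1] -/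
def word (ν : degLEMonomials n) (r : Fin n) : Fin (n + 1) :=
  ((wordMultiset n (ν : Fin n →₀ ℕ)).sort (· ≤ ·)).get
    (Fin.cast (by rw [Multiset.length_sort, card_wordMultiset n _ ν.2]) r)

/-- **The product of the letters of the word is the monomial**: `∏_r x̂_{word(ν)_r} = x^ν`.
[cite: ShpilkaVolkovich2015, Thm. 1] -/
theorem prod_letter_word (ν : degLEMonomials n) :
    ∏ r : Fin n, letter n (R := ℂ) (word n ν r) = monomial (ν : Fin n →₀ ℕ) 1 := by
  classical
  set L := (wordMultiset n (ν : Fin n →₀ ℕ)).sort (· ≤ ·) with hL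
  have hlen : L.length = n := by rw [hL, Multiset.length_sort, card_wordMultiset n _ ν.2]
  -- as a product over the list, then over the multiset
  have h1 : ∏ r : Fin n, letter n (R := ℂ) (word n ν r) = (L.map (letter n (R := ℂ))).prod := by
    rw [← Fin.prod_univ_fun_getElem L (letter n (R := ℂ))]
    exact (Fintype.prod_equiv (finCongr hlen.symm) _ _ fun r => rfl)
  rw [h1, ← Multiset.prod_coe, ← Multiset.map_coe, hL, Multiset.sort_eq, wordMultiset,
    Multiset.map_add, Multiset.prod_add, Multiset.map_nsmul, Multiset.prod_nsmul,
    Multiset.map_singleton, Multiset.prod_singleton, letter_zero, one_pow, mul_one,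
    Multiset.map_map]
  have hcomp : (letter n (R := ℂ)) ∘ Fin.succ = fun i => X i := funext fun i => letter_succ n i
  rw [hcomp, Finsupp.toMultiset_map, Finsupp.prod_toMultiset,
    Finsupp.prod_mapDomain_index (fun _ => pow_zero _) (fun _ _ _ => pow_add _ _ _),
    MvPolynomial.monomial_eq, C_1, one_mul]

/-- **`Λ_{word ν} = x^ν`.** [cite: ShpilkaVolkovich2015, Thm. 1] -/
theorem seed_word (ν : degLEMonomials n) :
    seed n (fun r => ((word n ν r : ℕ) : ℂ)) = monomial (ν : Fin n →₀ ℕ) 1 := by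
  unfold seed
  simp only [eval_interp_node]
  exact prod_letter_word n ν

end Word

/-! ### C. The generator's coordinate maps and the indicator property -/

section Indicator

variable (n : ℕ)

/-- The seed with INDETERMINATE parameters `Z_r` (coefficients in `ℂ[Z_1, …, Z_n]`).
[cite: ForbesShpilkaVolk2018, Construction 29] -/
def genericSeed : MvPolynomial (Fin n) (MvPolynomial (Fin n) ℂ) :=
  ∏ r : Fin n, ∑ i : Fin (n + 1),
    C (Polynomial.aeval (X r : MvPolynomial (Fin n) ℂ) (lag n i)) * letter n i

/-- **The coordinate maps** `L_μ(Z) = coeff_μ Λ_Z ∈ ℂ[Z]`. [cite: ForbesShpilkaVolk2018, Construction 29] -/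
def Lmap (μ : degLEMonomials n) : MvPolynomial (Fin n) ℂ :=
  coeff (μ : Fin n →₀ ℕ) (genericSeed n)

/-- Specialising the parameters gives the seed. [cite: ForbesShpilkaVolk2018, Construction 29] -/
theorem map_eval_genericSeed (σ : Fin n → ℂ) :
    MvPolynomial.map (eval σ) (genericSeed n) = seed n σ := by
  unfold genericSeed seed
  rw [map_prod]
  refine Finset.prod_congr rfl fun r _ => ?_
  rw [map_sum, eval_interp]
  refine Finset.sum_congr rfl fun i _ => ?_
  rw [map_mul, map_C, map_letter, GeneratorGlue.eval_polynomial_aeval_X]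

/-- `L_μ(σ) = coeff_μ Λ_σ`. [cite: ForbesShpilkaVolk2018, Construction 29] -/
theorem eval_Lmap (σ : Fin n → ℂ) (μ : degLEMonomials n) :
    eval σ (Lmap n μ) = coeff (μ : Fin n →₀ ℕ) (seed n σ) := by
  rw [Lmap, ← coeff_map, map_eval_genericSeed]

/-- **The indicator property**: `L_μ(word ν) = [μ = ν]`. [cite: ForbesShpilkaVolk2018, Lemma 28] -/
theorem indicator (μ ν : degLEMonomials n) :
    eval (fun r => ((word n ν r : ℕ) : ℂ)) (Lmap n μ) = if μ = ν then 1 else 0 := by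
  rw [eval_Lmap, seed_word, coeff_monomial]
  by_cases h : μ = ν
  · subst h; simp
  · rw [if_neg (fun h' => h (Subtype.ext h'.symm)), if_neg h]

end Indicator

/-! ### D. Cost: all seeds of a generator value from ONE coefficient vector -/

section Cost

variable (n : ℕ)

/-- The shared base family: the letters and the `2^K` coefficients of `R_x`.
[cite: GathenGerhard2013, §10.1 Cor. 10.8] -/
def base (K : ℕ) : Fin (n + 1) ⊕ Fin (2 ^ K) → MvPolynomial (Fin n) ℂ :=
  Sum.elim (letter n (R := ℂ)) (fun kk => (interp n).coeff kk)

/-- The base family costs `(n+1) 2^K` gates (a constant matrix applied to the letters).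
[cite: Burgisser2000, Def. 2.1] -/
theorem jointlyComputed_base (K : ℕ) : JointlyComputed (base n K) ((n + 1) * 2 ^ K) := by
  have hu : JointlyComputed (letter n (R := ℂ)) 0 := jointlyComputed_of_inputs _ (letter_cases n)
  have hc := jointlyComputed_lincomb_all hu (M := n + 1) (T := 2 ^ K)
    (fun kk i => (lag n i).coeff kk) id
  rw [Nat.zero_add] at hc
  refine hc.of_mem _ ?_
  rintro (i | kk)
  · exact Or.inl ⟨Sum.inl i, rfl⟩
  · refine Or.inl ⟨Sum.inr kk, ?_⟩
    simp only [base, Sum.elim_inr, coeff_interp]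
    rfl

/-- **The seeds of a generator value, jointly**: on top of the base family, each of `t` seeds
costs one multipoint evaluation (`remTreeCost K`) and `n − 1` products (`n ≥ 1`, `n + 1 ≤ 2^K`).
[cite: GathenGerhard2013, §10.1 Cor. 10.8] -/
theorem jointlyComputed_seeds (hn : 1 ≤ n) (K : ℕ) (hK : n + 1 ≤ 2 ^ K) :
    ∀ (t : ℕ) (σ : Fin t → Fin n → ℂ),
      JointlyComputed (Sum.elim (base n K) (fun j : Fin t => seed n (σ j)))
        ((n + 1) * 2 ^ K + t * (remTreeCost K + (n - 1)))
  | 0, σ => by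
    refine ((jointlyComputed_base n K).of_mem _ ?_).mono (by simp)
    rintro (b | j)
    · exact Or.inl ⟨b, rfl⟩
    · exact j.elim0
  | t + 1, σ => by
    classical
    have ih := jointlyComputed_seeds hn K hK t (fun j => σ (Fin.castSucc j))
    have hA : ∀ i, 2 ^ K ≤ i → (interp n).coeff i = 0 := fun i hi =>
      coeff_interp_eq_zero n (by omega)
    -- the values `R_x(σ_t r)`, `r < n`
    have h1 := jointlyComputed_multipoint zeta2 (fun κ => ((2 : ℂ) ^ κ)⁻¹) zeta2_pow
      (fun κ => mul_inv_cancel₀ (pow_ne_zero _ two_ne_zero)) ih K (interp n) hA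
      (fun kk => Sum.inl (Sum.inr kk)) (fun kk => rfl) (M := n) (by omega) (σ (Fin.last t))
    -- their product
    have h2 := jointlyComputed_fprod h1 (fun l => if h : l < n then
        (interp n).eval (C (σ (Fin.last t) ⟨l, h⟩)) else 1) (n - 1)
      (fun l => Sum.inr ⟨l, by omega⟩) (fun l => by
        have hl : (l : ℕ) < n := by omega
        simp [hl])
    have hcost : (n + 1) * 2 ^ K + t * (remTreeCost K + (n - 1)) + remTreeCost K + (n - 1) =
        (n + 1) * 2 ^ K + (t + 1) * (remTreeCost K + (n - 1)) := by ring
    rw [hcost] at h2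
    refine h2.of_mem _ ?_
    rintro (b | j)
    · exact Or.inl ⟨Sum.inl (Sum.inl (Sum.inl b)), rfl⟩
    · by_cases hj : (j : ℕ) < t
      · refine Or.inl ⟨Sum.inl (Sum.inl (Sum.inr ⟨j, hj⟩)), ?_⟩
        simp only [Sum.elim_inr, Sum.elim_inl]
        congr 2
      · have hjt : j = Fin.last t := Fin.ext (by have := j.isLt; simp [Fin.last]; omega)
        refine Or.inl ⟨Sum.inr (), ?_⟩
        simp only [Sum.elim_inr]
        rw [hjt, Nat.sub_add_cancel hn, ← Fin.prod_univ_eq_prod_range]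
        unfold seed
        refine Finset.prod_congr rfl fun r _ => ?_
        simp [r.isLt]

/-- **The value of the generator at a point and its size**: for `f₀` of size `≤ c₀`,
`L(f₀ + Σ_{j<t} w_j Λ_{σ_j}) ≤ c₀ + ((n+1)2^K + t(remTreeCost K + (n−1)) + t) + 1`.
[cite: GathenGerhard2013, §10.1 Cor. 10.8] -/
theorem complexity_value_le (hn : 1 ≤ n) (K : ℕ) (hK : n + 1 ≤ 2 ^ K) (t : ℕ)
    (w : Fin t → ℂ) (σ : Fin t → Fin n → ℂ) (f₀ : MvPolynomial (Fin n) ℂ) :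
    complexity (f₀ + ∑ j : Fin t, C (w j) * seed n (σ j)) ≤
      complexity f₀ + ((n + 1) * 2 ^ K + t * (remTreeCost K + (n - 1)) + t) + 1 := by
  have h := jointlyComputed_seeds n hn K hK t σ
  have h2 := jointlyComputed_lincomb_all h (M := t) (T := 1) (fun _ j => w j) (fun j => Sum.inr j)
  have h3 := h2.complexity_le (Sum.inr 0)
  simp only [Sum.elim_inr, smul_eq_C_mul, Nat.mul_one] at h3
  calc complexity (f₀ + ∑ j : Fin t, C (w j) * seed n (σ j))
      ≤ complexity f₀ + complexity (∑ j : Fin t, C (w j) * seed n (σ j)) + 1 :=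
        complexity_add_le_holds _ _
    _ ≤ _ := by gcongr

/-- Degree of the value: `≤ n`. [cite: ForbesShpilkaVolk2018, Construction 29] -/
theorem totalDegree_value_le (t : ℕ) (w : Fin t → ℂ) (σ : Fin t → Fin n → ℂ)
    (f₀ : MvPolynomial (Fin n) ℂ) (hf₀ : f₀.totalDegree ≤ n) :
    (f₀ + ∑ j : Fin t, C (w j) * seed n (σ j)).totalDegree ≤ n := by
  refine (totalDegree_add _ _).trans (max_le hf₀ (totalDegree_finsetSum_le fun j _ => ?_))
  calc (C (w j) * seed n (σ j)).totalDegree ≤ (C (w j) : MvPolynomial (Fin n) ℂ).totalDegree +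
        (seed n (σ j)).totalDegree := totalDegree_mul _ _
    _ ≤ n := by rw [totalDegree_C, zero_add]; exact totalDegree_seed_le n (σ j)

/-- **Coefficients of the value = the generator at the point.** With
`Γ_μ = coeff_μ f₀ + Σ_j W_j · L_μ(Z_j)`: `coeff_μ (f₀ + Σ_j w_j Λ_{σ_j}) = Γ_μ(w, σ)`.
[cite: ForbesShpilkaVolk2018, Construction 29] -/
theorem coeff_value (t : ℕ) (p : Fin t ⊕ (Fin t × Fin n) → ℂ) (f₀ : MvPolynomial (Fin n) ℂ)
    (μ : degLEMonomials n) :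
    coeff (μ : Fin n →₀ ℕ) (f₀ + ∑ j : Fin t, C (p (Sum.inl j)) * seed n (fun r => p (Sum.inr (j, r)))) =
      eval p (C (coeff (μ : Fin n →₀ ℕ) f₀) +
        ∑ j : Fin t, X (Sum.inl j) * rename (fun z => Sum.inr (j, z)) (Lmap n μ)) := by
  rw [GeneratorGlue.coeff_add_sum, GeneratorGlue.eval_generator]
  refine congrArg _ (Finset.sum_congr rfl fun j _ => ?_)
  rw [eval_Lmap]

end Cost

end AffineSeeds

end Summit.ValiantsHypothesis.ValiantsHypothesis.Theorems.BarrierLever.SuccinctHittingSetsForVP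

end
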